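import Summits.AtomisticToContinuum.Crystallization.Theorems.FrustratedLawDichotomyStrainedPatchConeWitnessKit

/-!
# ConeWitness kit, part 2 — L2 PROVED: no hcp fit below `η₀` near an fcc frame (`2(η₀ + θ) < 1/√3`)
# (27623 `AperiodicFrustratedLawGap`, T-far lane; lens-5 g95; discharges the typed `HcpExcludedNearFcc` of `…ConeWitnessKit`)

decomp-a2c lens-5 g95.  `hcpExcludedNearFcc_of_lt : 2 * (η₀ + θ) < 1/√3 → HcpExcludedNearFcc η₀ θ` and the record instance
`hcpExcludedNearFcc_record : HcpExcludedNearFcc (1/20) (17/500)`.  Ingredients: the fit lands in the forced shell (completeness below `13/10·d`),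
is injective (pattern separation `≥ 1 > 2η`) hence bijective (`12 = 12`); radial projection from outside the unit ball is non-expansive
(`norm_sub_le_norm_smul_sub`, the pin clause `d ≤ dist` puts every bond outside), so direction errors are `≤ η + θ`; the six antipodal pairs of the
cuboctahedron (central symmetry re-derived inline by `decide`; tree twins `…DefectFreeCrystallizes.Negative.TypeGap.fccInt_neg_mem`, `Literature…FlatleyTheil2015.neg_mem_fccKissingPattern` lie outside this import closure) pull back to pairs with `‖a + a'‖ < 1/√3`, antipodal in the anticuboctahedron by `hcpInt_add_sqNorm`; but `(3,3,0)/√18` has no antipode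
there.  Imports the tree file `…ConeWitnessKit` only (hand-2 edition 019dc3a6: the kit minus its two fcc `decide` cores, which this file does not use); no sorries; standard axioms; no instances / notation / options.  `--supports stmt-AtomisticToContinuum-27623`.
-/

namespace Summit.AtomisticToContinuum.Crystallization.Theorems.FrustratedLawDichotomyStrainedPatchConeWitnessKit

open scoped BigOperators RealInnerProductSpace
open Summit.AtomisticToContinuum.Crystallization.Theorems.ChargedEnergyGapNegative (E3)

/-! ## §3. L2 PROVED — no hcp fit below `η₀` near an fcc frame when `2(η₀ + θ) < 1/√3` (lens-5 g95, part 2)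

The finite geometry behind `HcpExcludedNearFcc`: an hcp fit `t` below `η₀` lands in the forced shell `s` (completeness below `13/10·d`), is injective
(pattern separation `≥ 1 > 2η`), hence a bijection `σ` between the two twelve-point patterns with direction errors `‖A a − g (σ a)‖ ≤ η + θ`
(radial projection from outside the unit ball is non-expansive — the pin clause `d ≤ dist` puts every bond outside); pulling back the SIX antipodal
pairs of the cuboctahedron gives `‖a + a'‖ = ‖A a + A a'‖ ≤ 2(η + θ) < 1/√3`, which in the anticuboctahedron forces `a' = −a`
(`hcpInt_add_sqNorm`; the cuboctahedron's central symmetry is re-derived inline by `decide`, its tree twins `…TypeGap.fccInt_neg_mem` / `Literature…FlatleyTheil2015.neg_mem_fccKissingPattern` lying outside this import closure) — so every hcp vector would have its antipode in the pattern, and `(1,1,0)/√2` does not. -/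

section FarClassL2

open Literature.Geometry.DiscreteGeometry (fccKissingPattern hcpKissingPattern fccInt hcpInt sqNormInt nearestDist intVec scaledPattern
  card_fccKissingPattern card_hcpKissingPattern norm_eq_one_of_mem_hcpKissingPattern norm_eq_one_of_mem_fccKissingPattern
  one_le_dist_of_mem_hcpKissingPattern norm_intVec scaledPattern_map_injective intVec_add)

/-- The anticuboctahedron is NOT centrally symmetric: `(3,3,0)/√18` is a pattern vector whose antipode is not. [folklore: decide + transport] -/
theorem exists_neg_not_mem_hcpKissingPattern : ∃ a ∈ hcpKissingPattern, -a ∉ hcpKissingPattern := by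
  have intVec_neg : ∀ v : Fin 3 → ℤ, intVec (-v) = -intVec v := fun v => by ext i; simp [intVec]
  have hv : (![3, 3, 0] : Fin 3 → ℤ) ∈ hcpInt := by decide
  have hnv : -(![3, 3, 0] : Fin 3 → ℤ) ∉ hcpInt := by decide
  refine ⟨(Real.sqrt (18 : ℕ))⁻¹ • intVec ![3, 3, 0], Finset.mem_image.2 ⟨_, hv, rfl⟩, fun hmem => hnv ?_⟩
  obtain ⟨w, hw, hwe⟩ := Finset.mem_image.1 hmem
  have h18 : (18 : ℕ) ≠ 0 := by norm_num
  have : w = -(![3, 3, 0] : Fin 3 → ℤ) := by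
    apply scaledPattern_map_injective h18
    simp only [hwe, intVec_neg, smul_neg]
  rw [← this]; exact hw

/-- ★ L2 core in real form: two anticuboctahedron vectors with `‖a + a'‖ < 1/√3` are antipodal (`hcpInt_add_sqNorm`: otherwise `‖a + a'‖² ≥ 6/18`).
[folklore] -/
theorem add_eq_zero_of_mem_hcpKissingPattern {a a' : E3} (ha : a ∈ hcpKissingPattern) (ha' : a' ∈ hcpKissingPattern)
    (h : ‖a + a'‖ < 1 / Real.sqrt 3) : a + a' = 0 := by
  have intVec_zero : intVec (0 : Fin 3 → ℤ) = 0 := by ext i; simp [intVec]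
  obtain ⟨v, hv, rfl⟩ := Finset.mem_image.1 ha
  obtain ⟨w, hw, rfl⟩ := Finset.mem_image.1 ha'
  rw [← smul_add, ← intVec_add] at h ⊢
  rcases hcpInt_add_sqNorm v hv w hw with h0 | h6
  · rw [h0, intVec_zero, smul_zero]
  · exfalso
    have hpos : (0 : ℝ) < Real.sqrt (18 : ℕ) := by positivity
    have h3 : (0 : ℝ) < Real.sqrt 3 := by positivity
    have hnorm : ‖(Real.sqrt (18 : ℕ))⁻¹ • intVec (v + w)‖ = (Real.sqrt (18 : ℕ))⁻¹ * Real.sqrt (sqNormInt (v + w) : ℝ) := by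
      rw [norm_smul, norm_inv, Real.norm_of_nonneg hpos.le, norm_intVec]
    have h6r : Real.sqrt 6 ≤ Real.sqrt (sqNormInt (v + w) : ℝ) := Real.sqrt_le_sqrt (by exact_mod_cast h6)
    have h18 : Real.sqrt (18 : ℕ) = Real.sqrt 3 * Real.sqrt 6 := by
      rw [show ((18 : ℕ) : ℝ) = 3 * 6 by norm_num, Real.sqrt_mul (by norm_num)]
    have h6pos : (0 : ℝ) < Real.sqrt 6 := by positivity
    have key : 1 / Real.sqrt 3 ≤ (Real.sqrt (18 : ℕ))⁻¹ * Real.sqrt (sqNormInt (v + w) : ℝ) := by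
      rw [h18, mul_inv, mul_assoc]
      have : 1 ≤ (Real.sqrt 6)⁻¹ * Real.sqrt (sqNormInt (v + w) : ℝ) := by
        rw [le_inv_mul_iff₀ h6pos, mul_one]; exact h6r
      calc 1 / Real.sqrt 3 = (Real.sqrt 3)⁻¹ * 1 := by rw [one_div, mul_one]
        _ ≤ (Real.sqrt 3)⁻¹ * ((Real.sqrt 6)⁻¹ * Real.sqrt (sqNormInt (v + w) : ℝ)) :=
          mul_le_mul_of_nonneg_left this (inv_nonneg.2 h3.le)
    rw [hnorm] at h
    exact absurd (lt_of_le_of_lt key h) (lt_irrefl _)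

/-- Radial projection from OUTSIDE the closed unit ball onto the unit sphere is non-expansive towards points of the ball:
`‖x‖ = 1`, `‖w‖ ≤ 1`, `r ≥ 1` ⟹ `‖x − w‖ ≤ ‖r•x − w‖`. [elementary] -/
theorem norm_sub_le_norm_smul_sub {x w : E3} (hx : ‖x‖ = 1) (hw : ‖w‖ ≤ 1) {r : ℝ} (hr : 1 ≤ r) : ‖x - w‖ ≤ ‖r • x - w‖ := by
  have e1 : ‖x - w‖ ^ 2 = ‖x‖ ^ 2 - 2 * ⟪x, w⟫ + ‖w‖ ^ 2 := norm_sub_sq_real x w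
  have e2 : ‖r • x - w‖ ^ 2 = ‖r • x‖ ^ 2 - 2 * ⟪r • x, w⟫ + ‖w‖ ^ 2 := norm_sub_sq_real (r • x) w
  have e3 : ‖r • x‖ = r := by rw [norm_smul, hx, mul_one, Real.norm_of_nonneg (by linarith)]
  have e4 : ⟪r • x, w⟫ = r * ⟪x, w⟫ := real_inner_smul_left x w r
  have e5 : ⟪x, w⟫ ≤ 1 := by
    have := real_inner_le_norm x w
    rw [hx, one_mul] at this
    exact this.trans hw
  have hsq : ‖x - w‖ ^ 2 ≤ ‖r • x - w‖ ^ 2 := by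
    rw [e1, e2, e3, e4, hx]; nlinarith
  nlinarith [norm_nonneg (x - w), norm_nonneg (r • x - w), hsq]

/-- Direction error of a fitted bond: `‖v − d•w‖ ≤ η d`, `‖w‖ = 1`, `d ≤ ‖v‖`, `0 < d` ⟹ `‖‖v‖⁻¹•v − w‖ ≤ η`. [elementary; the pin clause
`d ≤ dist` of `FitClauses` is what puts the bond outside the ball] -/
theorem norm_dir_sub_le {v w : E3} {d η : ℝ} (hd : 0 < d) (hw : ‖w‖ = 1) (hdv : d ≤ ‖v‖) (hfit : ‖v - d • w‖ ≤ η * d) :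
    ‖(‖v‖)⁻¹ • v - w‖ ≤ η := by
  have hvpos : 0 < ‖v‖ := lt_of_lt_of_le hd hdv
  set x : E3 := (‖v‖)⁻¹ • v with hxdef
  have hx : ‖x‖ = 1 := by rw [hxdef, norm_smul, norm_inv, norm_norm, inv_mul_cancel₀ hvpos.ne']
  -- `d⁻¹ • v = (‖v‖/d) • x` with `‖v‖/d ≥ 1`
  have hr : 1 ≤ ‖v‖ / d := by rw [le_div_iff₀ hd, one_mul]; exact hdv
  have hv' : (‖v‖ / d) • x = d⁻¹ • v := by
    rw [hxdef, smul_smul, div_eq_mul_inv, mul_comm (‖v‖) d⁻¹, mul_assoc, mul_inv_cancel₀ hvpos.ne', mul_one]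
  have hscaled : ‖d⁻¹ • v - w‖ ≤ η := by
    have : d⁻¹ • v - w = d⁻¹ • (v - d • w) := by rw [smul_sub, smul_smul, inv_mul_cancel₀ hd.ne', one_smul]
    rw [this, norm_smul, norm_inv, Real.norm_of_nonneg hd.le]
    calc d⁻¹ * ‖v - d • w‖ ≤ d⁻¹ * (η * d) := mul_le_mul_of_nonneg_left hfit (inv_nonneg.2 hd.le)
      _ = η := by field_simp
  calc ‖x - w‖ ≤ ‖(‖v‖ / d) • x - w‖ := norm_sub_le_norm_smul_sub hx hw.le hr
    _ = ‖d⁻¹ • v - w‖ := by rw [hv']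
    _ ≤ η := hscaled

/-- `1/√3 < 3/5`, hence `2(η₀ + θ) < 1/√3`, `θ ≥ 0` put `η₀` below `3/10` (used for `(1 + η)·d < 13/10·d`). [numeric] -/
theorem one_div_sqrt_three_lt : 1 / Real.sqrt 3 < 3 / 5 := by
  have h3 : (0 : ℝ) < Real.sqrt 3 := by positivity
  have h53 : (5 : ℝ) / 3 < Real.sqrt 3 := by
    rw [show Real.sqrt 3 = Real.sqrt 3 from rfl, Real.lt_sqrt (by norm_num)]; norm_num
  rw [div_lt_div_iff₀ h3 (by norm_num), one_mul]
  linarith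

/-- ★★ **L2 PROVED.** `2(η₀ + θ) < 1/√3 ⟹ HcpExcludedNearFcc η₀ θ`: a site whose first shell carries fcc frame data `(θ, g, s)` admits no hcp fit
below `η₀`.  (W94c: `η₀ = 1/20`, `θ = 17/500`: `2·0.084 = 0.168 < 0.577`.) -/
theorem hcpExcludedNearFcc_of_lt {η₀ θ : ℝ} (hsmall : 2 * (η₀ + θ) < 1 / Real.sqrt 3) : HcpExcludedNearFcc η₀ θ := by
  -- central symmetry of the cuboctahedron, re-derived inline by `decide` (tree twins, not in this import closure:
  -- `…DefectFreeCrystallizes.Negative.TypeGap.fccInt_neg_mem`, `Literature…FlatleyTheil2015.neg_mem_fccKissingPattern`)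
  have neg_mem_fccKissingPattern : ∀ {u : E3}, u ∈ fccKissingPattern → -u ∈ fccKissingPattern := by
    intro u hu
    obtain ⟨v, hv, rfl⟩ := Finset.mem_image.1 hu
    refine Finset.mem_image.2 ⟨-v, (by decide : ∀ v ∈ fccInt, -v ∈ fccInt) v hv, ?_⟩
    rw [show intVec (-v) = -intVec v from by ext i; simp [intVec], smul_neg]
  intro N y i g s hy hfr η γ A t hfit
  by_contra hlt
  rw [not_le] at hlt
  obtain ⟨hs_range, hs_ne, hs_dir, hs_dist, hs_complete⟩ := hfr
  obtain ⟨hd, hγ, hfitu, hpin1, hpin2, hgap⟩ := hfit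
  set d := nearestDist y i with hddef
  -- an element of each pattern; `θ ≥ 0`
  have hfne : fccKissingPattern.Nonempty := Finset.card_pos.1 (by rw [card_fccKissingPattern]; norm_num)
  obtain ⟨u₀, hu₀⟩ := hfne
  have hθ : 0 ≤ θ := (norm_nonneg _).trans (hs_dir ⟨u₀, hu₀⟩)
  have hη3 : η < 3 / 10 := by
    have := one_div_sqrt_three_lt; linarith
  -- unit pattern vectors are mapped to unit vectors
  have hAunit : ∀ a : ↥hcpKissingPattern, ‖A (a : E3)‖ = 1 := fun a => by
    rw [A.norm_map]; exact norm_eq_one_of_mem_hcpKissingPattern a.2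
  -- Step 1: every fitted bond lands in the forced shell, with direction error ≤ η + θ against the frame
  have step1 : ∀ a : ↥hcpKissingPattern, ∃ u : ↥fccKissingPattern, s u = t a ∧ ‖A (a : E3) - g (u : E3)‖ ≤ η + θ := by
    intro a
    obtain ⟨hty, hfa⟩ := hfitu a
    have hne : t a ≠ y i := by
      intro h
      rw [h, sub_self, zero_sub, norm_neg, norm_smul, Real.norm_of_nonneg hd.le, hAunit a, mul_one] at hfa
      nlinarith
    have hdle : d ≤ ‖t a - y i‖ := by rw [← dist_eq_norm]; exact hpin1 _ hty hne
    have hdist : dist (t a) (y i) < 13 / 10 * d := by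
      rw [dist_eq_norm]
      calc ‖t a - y i‖ = ‖(t a - y i - d • A (a : E3)) + d • A (a : E3)‖ := by rw [sub_add_cancel]
        _ ≤ ‖t a - y i - d • A (a : E3)‖ + ‖d • A (a : E3)‖ := norm_add_le _ _
        _ ≤ η * d + d := by
            rw [norm_smul, Real.norm_of_nonneg hd.le, hAunit a, mul_one]; exact add_le_add hfa le_rfl
        _ < 13 / 10 * d := by nlinarith
    obtain ⟨u, hu⟩ := hs_complete (t a) hty hne hdist
    refine ⟨u, hu, ?_⟩
    have hdirA : ‖(‖t a - y i‖)⁻¹ • (t a - y i) - A (a : E3)‖ ≤ η := norm_dir_sub_le hd (hAunit a) hdle hfa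
    have hdirg : ‖(‖s u - y i‖)⁻¹ • (s u - y i) - g (u : E3)‖ ≤ θ := hs_dir u
    rw [hu] at hdirg
    calc ‖A (a : E3) - g (u : E3)‖
        = ‖((‖t a - y i‖)⁻¹ • (t a - y i) - g (u : E3)) - ((‖t a - y i‖)⁻¹ • (t a - y i) - A (a : E3))‖ := by
          congr 1; abel
      _ ≤ ‖(‖t a - y i‖)⁻¹ • (t a - y i) - g (u : E3)‖ + ‖(‖t a - y i‖)⁻¹ • (t a - y i) - A (a : E3)‖ := norm_sub_le _ _
      _ ≤ θ + η := add_le_add hdirg hdirA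
      _ = η + θ := add_comm _ _
  choose σ hσs hσdir using step1
  -- Step 2: σ is injective (two hcp vectors fitted to the same shell point are within 2η < 1), hence bijective (12 = 12)
  have hσinj : Function.Injective σ := by
    intro a a' haa
    have ht : t a = t a' := by rw [← hσs a, ← hσs a', haa]
    by_contra hne
    have hne' : (a : E3) ≠ (a' : E3) := fun h => hne (Subtype.ext h)
    have h1 := one_le_dist_of_mem_hcpKissingPattern a.2 a'.2 hne'
    have hfa := (hfitu a).2
    have hfa' := (hfitu a').2
    rw [ht] at hfa
    have hdd : ‖d • A (a : E3) - d • A (a' : E3)‖ ≤ η * d + η * d := by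
      calc ‖d • A (a : E3) - d • A (a' : E3)‖
          = ‖(t a' - y i - d • A (a' : E3)) - (t a' - y i - d • A (a : E3))‖ := by congr 1; abel
        _ ≤ ‖t a' - y i - d • A (a' : E3)‖ + ‖t a' - y i - d • A (a : E3)‖ := norm_sub_le _ _
        _ ≤ η * d + η * d := add_le_add hfa' hfa
    rw [← smul_sub, norm_smul, Real.norm_of_nonneg hd.le, ← map_sub, A.norm_map, ← dist_eq_norm] at hdd
    nlinarith
  have hσbij : Function.Bijective σ := by
    rw [Fintype.bijective_iff_injective_and_card]
    exact ⟨hσinj, by rw [Fintype.card_coe, Fintype.card_coe, card_hcpKissingPattern, card_fccKissingPattern]⟩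
  -- Step 3: every hcp vector has its antipode in the pattern
  have step3 : ∀ a : ↥hcpKissingPattern, -(a : E3) ∈ hcpKissingPattern := by
    intro a
    obtain ⟨a', ha'⟩ := hσbij.2 ⟨-(σ a : E3), neg_mem_fccKissingPattern (σ a).2⟩
    have hsum : ‖(a : E3) + (a' : E3)‖ < 1 / Real.sqrt 3 := by
      have hga : g (-(σ a : E3)) = -g (σ a : E3) := g.map_neg _
      have h2 := hσdir a'
      rw [ha'] at h2
      change ‖A (a' : E3) - g (-(σ a : E3))‖ ≤ η + θ at h2
      rw [hga, sub_neg_eq_add] at h2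
      calc ‖(a : E3) + (a' : E3)‖ = ‖A ((a : E3) + (a' : E3))‖ := (A.norm_map _).symm
        _ = ‖(A (a : E3) - g (σ a : E3)) + (A (a' : E3) + g (σ a : E3))‖ := by rw [map_add]; congr 1; abel
        _ ≤ ‖A (a : E3) - g (σ a : E3)‖ + ‖A (a' : E3) + g (σ a : E3)‖ := norm_add_le _ _
        _ ≤ (η + θ) + (η + θ) := add_le_add (hσdir a) h2
        _ < 1 / Real.sqrt 3 := by linarith
    have h0 := add_eq_zero_of_mem_hcpKissingPattern a.2 a'.2 hsum
    have : -(a : E3) = (a' : E3) := by rw [neg_eq_iff_add_eq_zero]; exact h0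
    rw [this]; exact a'.2
  -- Step 4: but `(3,3,0)/√18` has no antipode in the anticuboctahedron
  obtain ⟨a₀, ha₀, hna₀⟩ := exists_neg_not_mem_hcpKissingPattern
  exact hna₀ (step3 ⟨a₀, ha₀⟩)

/-- The record instance: `η₀ = 1/20`, `θ₀ = 17/500` (`2·(1/20 + 17/500) = 21/125 = 0.168 < 0.577`). -/
theorem hcpExcludedNearFcc_record : HcpExcludedNearFcc (1 / 20) (17 / 500) := by
  apply hcpExcludedNearFcc_of_lt
  have h3 : (0 : ℝ) < Real.sqrt 3 := by positivity
  have hs : Real.sqrt 3 < 2 := by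
    rw [Real.sqrt_lt' (by norm_num)]; norm_num
  rw [lt_div_iff₀ h3]; nlinarith

end FarClassL2

end Summit.AtomisticToContinuum.Crystallization.Theorems.FrustratedLawDichotomyStrainedPatchConeWitnessKit
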